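import Summits.CriticalPhenomena.CardyFormulaZ2.Theorems.CardyComplexConeEdgePrecompactUFRSMarkedDecayRectTerm

/-!
# UFRS, decay at the marked points (rectangles), part 6: the collar of a rectangle, rows of boxes
(line `qkz-strip-boundary-arm` of crux `CardyComplexCone.EdgePrecompact`, stmt-CriticalPhenomena-11387;
support for the registered sub-goal `ufrs_markedPointDecay_rect`, wave 3 of lead c4)

Geometry of the `3η`-collar of an open axis-parallel rectangle and the summation of the per-box
bounds of part 5 along one row of boxes:

* `near_side_W3M` — a point within `t` of the complement of the rectangle is within `t` of one of
  the four sides (in the corresponding coordinate); `grid_index_W3M` — grid abscissae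
  `x₀ + (j + 1/2) η`, `j < ⌊(x₁ - x₀)/η⌋`, come within `3η/2` of every `x ∈ (x₀, x₁)`;
  `infDist_compl_le_of_im/re_W3M` — depth of a point of the rectangle; `hgrid_sep_W3M`,
  `vgrid_sep_W3M` — grid points are `η`-separated;
* `card_filter_near_le_W3M` — along an `η`-separated sequence at most `2T/η + 1` points are within
  `T` of a given point; `sum_line_le_W3M` (registered anchor) — hence terms vanishing outside that
  range and bounded by `B` sum to `≤ (2T/η + 1) B`; `row_bound_W3M` — with `T = 2U + 3η` and the
  per-box bound `K (η/U)^{1+α} (U/ρ)^β` this is `≤ 11 K (η/ρ)^{min α β}`;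
* `markedRow_le_W3M` — one row of boxes of the MARKED branch costs `≤ 11 K (η/ρ)^{min α β}`.

References: G. F. Lawler, O. Schramm, W. Werner, Electron. J. Probab. 7 (2002), Appendix A
(summing boundary arm events over boxes).
-/

namespace Summit.CriticalPhenomena.CardyFormulaZ2.Cruxes.EdgePrecompact.QkzStripBoundaryArm

open MeasureTheory Filter Set Metric
open scoped Topology BigOperators Pointwise
open Literature.Probability.LatticeModels Literature.Probability.Percolation
open Literature.Probability.RandomPlanarGeometry (DobrushinDomain)
open Summit.CriticalPhenomena.CardyFormulaZ2.Theses.CardyComplexCone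

noncomputable section

/-! ## Part 7: geometry of the collar of a rectangle -/

/-- **A collar point of an open rectangle is near one of its four sides.** -/
theorem near_side_W3M {x₀ x₁ y₀ y₁ t : ℝ} {z : ℂ}
    (ht : infDist z (Set.Ioo x₀ x₁ ×ℂ Set.Ioo y₀ y₁)ᶜ < t) :
    z.im - y₀ < t ∨ y₁ - z.im < t ∨ z.re - x₀ < t ∨ x₁ - z.re < t := by
  by_contra hcon
  simp only [not_or, not_lt] at hcon
  obtain ⟨h1, h2, h3, h4⟩ := hcon
  have hne : (Set.Ioo x₀ x₁ ×ℂ Set.Ioo y₀ y₁)ᶜ.Nonempty := by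
    refine ⟨(x₀ : ℂ), fun h => ?_⟩
    have h' := ((Complex.mem_reProdIm).1 h).1.1
    simp at h'
  have : t ≤ infDist z (Set.Ioo x₀ x₁ ×ℂ Set.Ioo y₀ y₁)ᶜ := by
    refine (Metric.le_infDist hne).2 fun w hw => ?_
    by_contra hlt
    rw [not_le] at hlt
    have hre := abs_le.1 (Complex.abs_re_le_norm (z - w))
    have him := abs_le.1 (Complex.abs_im_le_norm (z - w))
    rw [← Complex.dist_eq] at hre him
    simp only [Complex.sub_re, Complex.sub_im] at hre him
    apply hw
    rw [Complex.mem_reProdIm, Set.mem_Ioo, Set.mem_Ioo]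
    refine ⟨⟨?_, ?_⟩, ?_, ?_⟩ <;> linarith [hre.1, hre.2, him.1, him.2]
  linarith

/-- **Grid index along a side.** For `x₀ < x < x₁` and a step `η > 0` with `2η ≤ x₁ - x₀`, some
grid abscissa `x₀ + (j + 1/2) η`, `j < ⌊(x₁ - x₀)/η⌋₊`, is within `3η/2` of `x`. -/
theorem grid_index_W3M {x₀ x₁ x η : ℝ} (hη : 0 < η) (hℓ : 2 * η ≤ x₁ - x₀) (hx₀ : x₀ < x) (hx₁ : x < x₁) :
    ∃ j : ℕ, j < ⌊(x₁ - x₀) / η⌋₊ ∧ |x - (x₀ + ((j : ℝ) + 1 / 2) * η)| ≤ 3 * η / 2 := by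
  set N := ⌊(x₁ - x₀) / η⌋₊ with hN
  have hN1 : 1 ≤ N := by
    rw [hN, Nat.one_le_floor_iff, le_div_iff₀ hη]; linarith
  have hNle : (N : ℝ) * η ≤ x₁ - x₀ := by
    have := Nat.floor_le (div_nonneg (by linarith : 0 ≤ x₁ - x₀) hη.le)
    rw [← hN] at this
    rwa [le_div_iff₀ hη] at this
  have hNgt : x₁ - x₀ < ((N : ℝ) + 1) * η := by
    have := Nat.lt_floor_add_one ((x₁ - x₀) / η)
    rw [← hN] at this
    rwa [div_lt_iff₀ hη] at this
  set j₀ := ⌊(x - x₀) / η⌋₊ with hj₀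
  have hj₀le : (j₀ : ℝ) * η ≤ x - x₀ := by
    have := Nat.floor_le (div_nonneg (by linarith : 0 ≤ x - x₀) hη.le)
    rw [← hj₀] at this
    rwa [le_div_iff₀ hη] at this
  have hj₀gt : x - x₀ < ((j₀ : ℝ) + 1) * η := by
    have := Nat.lt_floor_add_one ((x - x₀) / η)
    rw [← hj₀] at this
    rwa [div_lt_iff₀ hη] at this
  rcases Nat.lt_or_ge j₀ N with hlt | hge
  · refine ⟨j₀, hlt, abs_le.2 ⟨?_, ?_⟩⟩ <;> nlinarith
  · refine ⟨N - 1, Nat.sub_lt hN1 Nat.one_pos, ?_⟩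
    have hcast : ((N - 1 : ℕ) : ℝ) = (N : ℝ) - 1 := by
      rw [Nat.cast_sub hN1, Nat.cast_one]
    rw [hcast]
    have hge' : (N : ℝ) ≤ j₀ := by exact_mod_cast hge
    refine abs_le.2 ⟨?_, ?_⟩ <;> nlinarith

/-- **Counting grid points near a point.** Along a sequence of points `p j` with
`η |j - j'| ≤ dist (p j) (p j')` (`η > 0`), at most `2T/η + 1` indices `j < N` have
`dist (p j) c ≤ T`. -/
theorem card_filter_near_le_W3M {η : ℝ} (hη : 0 < η) (p : ℕ → ℂ)
    (hp : ∀ j j' : ℕ, η * |(j : ℝ) - j'| ≤ dist (p j) (p j')) (c : ℂ) {T : ℝ} (hT : 0 ≤ T) (N : ℕ) :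
    ((((Finset.range N).filter fun j => dist (p j) c ≤ T).card : ℕ) : ℝ) ≤ 2 * T / η + 1 := by
  set S := (Finset.range N).filter fun j => dist (p j) c ≤ T with hS
  rcases S.eq_empty_or_nonempty with hemp | hne
  · rw [hemp, Finset.card_empty, Nat.cast_zero]; positivity
  · set j₀ := S.min' hne with hj₀
    have hj₀S : j₀ ∈ S := Finset.min'_mem S hne
    have hsub : S ⊆ Finset.Icc j₀ (j₀ + ⌊2 * T / η⌋₊) := by
      intro j hj
      rw [Finset.mem_Icc]
      refine ⟨Finset.min'_le S j hj, ?_⟩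
      have hjc : dist (p j) c ≤ T := (Finset.mem_filter.1 hj).2
      have hj₀c : dist (p j₀) c ≤ T := (Finset.mem_filter.1 hj₀S).2
      have hd : dist (p j) (p j₀) ≤ 2 * T := by
        have := dist_triangle (p j) c (p j₀)
        rw [dist_comm c] at this
        linarith
      have h1 := hp j j₀
      have hle : (j₀ : ℝ) ≤ j := by exact_mod_cast Finset.min'_le S j hj
      rw [abs_of_nonneg (by linarith)] at h1
      have h2 : ((j - j₀ : ℕ) : ℝ) ≤ 2 * T / η := by
        rw [Nat.cast_sub (by exact_mod_cast hle), le_div_iff₀ hη]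
        nlinarith
      have h3 : j - j₀ ≤ ⌊2 * T / η⌋₊ := Nat.le_floor h2
      omega
    calc ((S.card : ℕ) : ℝ) ≤ ((Finset.Icc j₀ (j₀ + ⌊2 * T / η⌋₊)).card : ℝ) := by
          exact_mod_cast Finset.card_le_card hsub
      _ = ⌊2 * T / η⌋₊ + 1 := by
          rw [Nat.card_Icc]; push_cast [Nat.cast_sub (by omega : j₀ ≤ j₀ + ⌊2 * T / η⌋₊ + 1)]; ring
      _ ≤ 2 * T / η + 1 := by linarith [Nat.floor_le (by positivity : 0 ≤ 2 * T / η)]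

/-- Horizontal grid points are `η`-separated: `η |j - j'| ≤ dist`. -/
theorem hgrid_sep_W3M (x₀ y η : ℝ) (hη : 0 ≤ η) (j j' : ℕ) :
    η * |(j : ℝ) - j'| ≤ dist (Complex.mk (x₀ + ((j : ℝ) + 1 / 2) * η) y) (Complex.mk (x₀ + ((j' : ℝ) + 1 / 2) * η) y) := by
  have hre : (Complex.mk (x₀ + ((j : ℝ) + 1 / 2) * η) y - Complex.mk (x₀ + ((j' : ℝ) + 1 / 2) * η) y).re =
      η * ((j : ℝ) - j') := by
    simp only [Complex.sub_re]; ring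
  rw [Complex.dist_eq]
  refine le_trans (le_of_eq ?_) (Complex.abs_re_le_norm _)
  rw [hre, abs_mul, abs_of_nonneg hη]

/-- Vertical grid points are `η`-separated: `η |j - j'| ≤ dist`. -/
theorem vgrid_sep_W3M (x y₀ η : ℝ) (hη : 0 ≤ η) (j j' : ℕ) :
    η * |(j : ℝ) - j'| ≤ dist (Complex.mk x (y₀ + ((j : ℝ) + 1 / 2) * η)) (Complex.mk x (y₀ + ((j' : ℝ) + 1 / 2) * η)) := by
  have him : (Complex.mk x (y₀ + ((j : ℝ) + 1 / 2) * η) - Complex.mk x (y₀ + ((j' : ℝ) + 1 / 2) * η)).im =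
      η * ((j : ℝ) - j') := by
    simp only [Complex.sub_im]; ring
  rw [Complex.dist_eq]
  refine le_trans (le_of_eq ?_) (Complex.abs_im_le_norm _)
  rw [him, abs_mul, abs_of_nonneg hη]

/-- Distance in `ℂ` is at most the sum of the coordinate distances (private copy of a folklore
inequality landed elsewhere in the tree, to keep the import closure of the line small). -/
private theorem dist_le_re_add_im_W3M (z w : ℂ) : dist z w ≤ |z.re - w.re| + |z.im - w.im| := by
  rw [Complex.dist_eq, ← Complex.sub_re, ← Complex.sub_im]
  exact Complex.norm_le_abs_re_add_abs_im _

/-- A point of the open rectangle at distance `≤ t` (in a coordinate) from a side is within `t`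
of the complement: `infDist ≤ t`. Bottom/top version (second coordinate). -/
theorem infDist_compl_le_of_im_W3M {x₀ x₁ y₀ y₁ t : ℝ} (z : ℂ) (h : z.im - y₀ ≤ t ∨ y₁ - z.im ≤ t)
    (hz : z ∈ Set.Ioo x₀ x₁ ×ℂ Set.Ioo y₀ y₁) : infDist z (Set.Ioo x₀ x₁ ×ℂ Set.Ioo y₀ y₁)ᶜ ≤ t := by
  have hzi := ((Complex.mem_reProdIm).1 hz).2
  rcases h with h | h
  · refine le_trans (Metric.infDist_le_dist_of_mem (y := Complex.mk z.re y₀) fun hm => ?_) ?_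
    · have := ((Complex.mem_reProdIm).1 hm).2; simp at this
    · refine le_trans (dist_le_re_add_im_W3M _ _) ?_
      simp only [sub_self, abs_zero, zero_add]
      rw [abs_of_nonneg (by linarith [hzi.1])]; exact h
  · refine le_trans (Metric.infDist_le_dist_of_mem (y := Complex.mk z.re y₁) fun hm => ?_) ?_
    · have := ((Complex.mem_reProdIm).1 hm).2; simp at this
    · refine le_trans (dist_le_re_add_im_W3M _ _) ?_
      simp only [sub_self, abs_zero, zero_add]
      rw [abs_of_nonpos (by linarith [hzi.2])]; linarith

/-- Left/right version (first coordinate) of `infDist_compl_le_of_im_W3M`. -/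
theorem infDist_compl_le_of_re_W3M {x₀ x₁ y₀ y₁ t : ℝ} (z : ℂ) (h : z.re - x₀ ≤ t ∨ x₁ - z.re ≤ t)
    (hz : z ∈ Set.Ioo x₀ x₁ ×ℂ Set.Ioo y₀ y₁) : infDist z (Set.Ioo x₀ x₁ ×ℂ Set.Ioo y₀ y₁)ᶜ ≤ t := by
  have hzr := ((Complex.mem_reProdIm).1 hz).1
  rcases h with h | h
  · refine le_trans (Metric.infDist_le_dist_of_mem (y := Complex.mk x₀ z.im) fun hm => ?_) ?_
    · have := ((Complex.mem_reProdIm).1 hm).1; simp at this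
    · refine le_trans (dist_le_re_add_im_W3M _ _) ?_
      simp only [sub_self, abs_zero, add_zero]
      rw [abs_of_nonneg (by linarith [hzr.1])]; exact h
  · refine le_trans (Metric.infDist_le_dist_of_mem (y := Complex.mk x₁ z.im) fun hm => ?_) ?_
    · have := ((Complex.mem_reProdIm).1 hm).1; simp at this
    · refine le_trans (dist_le_re_add_im_W3M _ _) ?_
      simp only [sub_self, abs_zero, add_zero]
      rw [abs_of_nonpos (by linarith [hzr.2])]; linarith

/-! ## Part 8: one row of boxes -/

/-- **Summing a row.** Nonnegative terms `f j`, `j < N`, vanishing unless `dist (p j) c ≤ T` and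
bounded by `B ≥ 0`, along an `η`-separated sequence `p`, sum to at most `(2T/η + 1) B`. -/
theorem sum_line_le_W3M : ∀ {η T B : ℝ}, 0 < η → 0 ≤ T → 0 ≤ B → ∀ (p : ℕ → ℂ), (∀ j j' : ℕ, η * |(j : ℝ) - j'| ≤ dist (p j) (p j')) → ∀ (c : ℂ) (N : ℕ) (f : ℕ → ℝ), (∀ j, ¬ dist (p j) c ≤ T → f j = 0) → (∀ j < N, f j ≤ B) → ∑ j ∈ Finset.range N, f j ≤ (2 * T / η + 1) * B := by
  intro η T B hη hT hB p hp c N f hfz hfb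
  classical
  rw [← Finset.sum_filter_add_sum_filter_not (Finset.range N) (fun j => dist (p j) c ≤ T) f,
    Finset.sum_eq_zero (s := (Finset.range N).filter fun j => ¬ dist (p j) c ≤ T)
      (fun j hj => hfz j (Finset.mem_filter.1 hj).2), add_zero]
  calc ∑ j ∈ (Finset.range N).filter (fun j => dist (p j) c ≤ T), f j
      ≤ ∑ _j ∈ (Finset.range N).filter (fun j => dist (p j) c ≤ T), B :=
        Finset.sum_le_sum fun j hj => hfb j (Finset.mem_range.1 (Finset.mem_filter.1 hj).1)
    _ = (((Finset.range N).filter (fun j => dist (p j) c ≤ T)).card : ℝ) * B := by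
        rw [Finset.sum_const, nsmul_eq_mul]
    _ ≤ (2 * T / η + 1) * B := mul_le_mul_of_nonneg_right (card_filter_near_le_W3M hη p hp c hT N) hB

/-- **The row bound in closed form**: with `T = 2U + 3η`, `η ≤ U ≤ ρ/2`,
`(2T/η + 1) · K (η/U)^{1+α} (U/ρ)^β ≤ 11 K (η/ρ)^{min α β}`. -/
theorem row_bound_W3M {η U ρ K α β : ℝ} (hη : 0 < η) (hU : η ≤ U) (hUρ : U ≤ ρ / 2) (hK : 0 ≤ K)
    (hα : 0 < α) (hβ : 0 < β) :
    (2 * (2 * U + 3 * η) / η + 1) * (K * ((η / U) ^ (1 + α) * (U / ρ) ^ β)) ≤ 11 * K * (η / ρ) ^ min α β := by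
  have hUpos : 0 < U := by linarith
  have hρ : 0 < ρ := by linarith
  have h1 : 2 * (2 * U + 3 * η) / η + 1 ≤ 11 * (U / η) := by
    rw [div_add_one (ne_of_gt hη), div_le_iff₀ hη]
    field_simp
    nlinarith
  have h2 : (η / U) ^ (1 + α) = (η / U) * (η / U) ^ α := by
    rw [Real.rpow_add (by positivity), Real.rpow_one]
  have h3 : (η / U) ^ α * (U / ρ) ^ β ≤ (η / ρ) ^ min α β := by
    have := rpow_mul_rpow_le_W3M (x := η / U) (y := U / ρ) (by positivity)
      ((div_le_one hUpos).2 hU) (by positivity) ((div_le_one hρ).2 (by linarith)) hα hβ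
    rwa [show η / U * (U / ρ) = η / ρ by field_simp] at this
  calc (2 * (2 * U + 3 * η) / η + 1) * (K * ((η / U) ^ (1 + α) * (U / ρ) ^ β))
      ≤ 11 * (U / η) * (K * ((η / U) ^ (1 + α) * (U / ρ) ^ β)) :=
        mul_le_mul_of_nonneg_right h1 (by positivity)
    _ = 11 * K * ((U / η) * (η / U) * ((η / U) ^ α * (U / ρ) ^ β)) := by rw [h2]; ring
    _ = 11 * K * ((η / U) ^ α * (U / ρ) ^ β) := by
        rw [show U / η * (η / U) = 1 by field_simp, one_mul]
    _ ≤ 11 * K * (η / ρ) ^ min α β := mul_le_mul_of_nonneg_left h3 (by positivity)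

/-- **One row of boxes of the MARKED branch.** Along an `η`-separated row of box centres
`p j ∈ D` within `2η` of `∂D` (`j < N`), for a marked edge `e₀`, a class `U ≥ η` and scales
`d > 0`, `0 < R' ≤ ρ/8`, the per-box events of `markedTerm_le_W3M` have total probability at most
`11 K (η/ρ)^{min α β}`: only the `≤ 4U/η + 7` boxes within `2U + 3η` of the marked edge contribute
(`sum_line_le_W3M`), each at most `K (η/U)^{1+α} (U/ρ)^β`. -/
theorem markedRow_le_W3M {D : DobrushinDomain} {E : DiscreteDobrushin} {w : Site 2}
    {η ρ U d R' CT α CJ β : ℝ} {e₀ : Sym2 (Site 2)} (p : ℕ → ℂ) (N : ℕ) (hE : E.IsZdAdmissible) (hδη : E.δ ≤ η / 4)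
    (hT : ∀ (z : ℂ) (s S : ℝ), z ∈ D.carrier → infDist z D.carrierᶜ ≤ s → η ≤ s → 0 < S →
      (∀ e' : Sym2 (Site 2), (e' ∈ E.zdABEdges ∨ e' ∈ (shiftData E w).zdABEdges) → 2 * S ≤ dist (medialPoint E.δ e') z) →
      (bondPercolation (zdGraph 2) half).real (ufrsStrands E w z 3 s S) ≤ CT * (s / S) ^ (1 + α))
    (hJ : ∀ e' : Sym2 (Site 2), (e' ∈ E.zdABEdges ∨ e' ∈ (shiftData E w).zdABEdges) → ∀ s S : ℝ, η ≤ s → 0 < S →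
      (bondPercolation (zdGraph 2) half).real (ufrsStrands E w (medialPoint E.δ e') 2 s S) ≤ CJ * (s / S) ^ β)
    (he₀ : e₀ ∈ E.zdABEdges ∨ e₀ ∈ (shiftData E w).zdABEdges)
    (hp : ∀ j j' : ℕ, η * |(j : ℝ) - j'| ≤ dist (p j) (p j'))
    (hpD : ∀ j < N, p j ∈ D.carrier ∧ infDist (p j) D.carrierᶜ ≤ 2 * η)
    (hη : 0 < η) (hU : η ≤ U) (hd : 0 < d) (hR' : 0 < R') (hR'ρ : R' ≤ ρ / 8) (hα : 0 < α) (hβ : 0 < β) :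
    ∑ j ∈ Finset.range N, (bondPercolation (zdGraph 2) half).real {ω : BondConfig (Site 2) |
      (dist (p j) (medialPoint E.δ e₀) ≤ 2 * U + 3 * η ∧ U ≤ 4 * R' ∧ 16 * d ≤ R' ∧ (64 * η ≤ U → ∀ e' : Sym2 (Site 2),
        (e' ∈ E.zdABEdges ∨ e' ∈ (shiftData E w).zdABEdges) → U - 3 * η ≤ dist (medialPoint E.δ e') (p j))) ∧
      ((64 * η ≤ U ∧ 32 * η ≤ d) → ω ∈ ufrsStrands E w (p j) 3 (7 * η) (min (d / 2) (U / 4) - 3 * η)) ∧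
      ((64 * η ≤ U ∧ d ≤ U / 16) → ω ∈ ufrsStrands E w (p j) 3 (2 * d + 3 * η) (U / 4 - 3 * η)) ∧
      (64 * U ≤ d → ω ∈ ufrsStrands E w (medialPoint E.δ e₀) 2 (6 * U) (d / 2 - 2 * U)) ∧
      (64 * U ≤ R' → ω ∈ ufrsStrands E w (medialPoint E.δ e₀) 2 (max (2 * d) (4 * U) + 2 * U) (R' - 2 * U)) ∧
      (64 * U ≤ ρ → ω ∈ ufrsStrands E w (medialPoint E.δ e₀) 2 (8 * R' + 2 * U) (ρ / 4 - 2 * U))} ≤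
    11 * ((max CT 1) ^ 2 * (512 : ℝ) ^ (1 + α) * ((max CJ 1) ^ 3 * (262144 : ℝ) ^ β)) * (η / ρ) ^ min α β := by
  have hρ : 0 < ρ := by linarith
  have hUpos : 0 < U := by linarith
  have hK : 0 ≤ (max CT 1) ^ 2 * (512 : ℝ) ^ (1 + α) * ((max CJ 1) ^ 3 * (262144 : ℝ) ^ β) := by positivity
  by_cases hU4 : U ≤ 4 * R'
  · refine le_trans (sum_line_le_W3M hη (by positivity : (0 : ℝ) ≤ 2 * U + 3 * η) (B := (max CT 1) ^ 2 * (512 : ℝ) ^ (1 + α) *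
        ((max CJ 1) ^ 3 * (262144 : ℝ) ^ β) * ((η / U) ^ (1 + α) * (U / ρ) ^ β)) (by positivity) p hp
        (medialPoint E.δ e₀) N _ (fun j hj => ?_) (fun j hj => ?_)) ?_
    · refine le_antisymm (le_trans (measureReal_mono (s₂ := (∅ : Set (BondConfig (Site 2))))
        (fun ω hω => (hj (Set.mem_setOf_eq ▸ hω).1.1).elim) (by simp)) (by rw [measureReal_empty])) measureReal_nonneg
    · exact markedTerm_le_W3M hE hδη hT hJ (hpD j hj).1 (hpD j hj).2 he₀ hη hU hd hR' hρ hα hβ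
    · exact row_bound_W3M hη hU (by linarith) hK hα hβ
  · -- the class is too large for the outer scale: every term vanishes
    refine le_trans (le_of_eq (Finset.sum_eq_zero fun j _ => ?_)) (by positivity)
    exact le_antisymm (le_trans (measureReal_mono (s₂ := (∅ : Set (BondConfig (Site 2))))
      (fun ω hω => (hU4 (Set.mem_setOf_eq ▸ hω).1.2.1).elim) (by simp)) (by rw [measureReal_empty])) measureReal_nonneg

end

end Summit.CriticalPhenomena.CardyFormulaZ2.Cruxes.EdgePrecompact.QkzStripBoundaryArm
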